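import Summits.AtomisticToContinuum.Crystallization.Theorems.OverbindingBudgetHarmonicNormalFormSeam

/-!
# OverbindingBudget — the balanced deep census in HARMONIC NORMAL FORM (decomp-a2c lens-4, generation 41)

Draft node of decomp-a2c lens-4 g41 (critic row 593 (3); I-ZS = census TAG 191 reported 2026-08-31T23:34Z, critic row 605).  Target of record (cone XLVI, slot 3):
`TameBalancedDeepScaleGap (122/125) 0 4 (3/50) (1/450)` («TBDSG»).

## §1–§3  LAYER 1 — the TOLERANCE SEAM (PROVED, generic).
The registration tolerance `ε` of `Framed ε g` is a free dial of the leaf: `Framed` is MONOTONE in `ε`, so pricing only the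
`ε₁`-FINELY registered scale-bad sites (and rebating every not-`ε₁`-finely-deep site) is KERNEL-WEAKER
(`tameBalancedDeepScaleGap_anti_tol`, PROVED).  The complement is a census of its own,
`TameBalancedMidGap ρ ρ₁ ε₁ ε g` («MID»): the sites that are `(ρ, ε)`-deep but NOT `(ρ₁, ε₁)`-deep — every one of them has, within
`ρ₁·nn`, a charge-free framed site whose two-shell frame misfit exceeds `ε₁` (or an unregistered one) — are priced IN AGGREGATE at
`c > 0` each, with the same rebates (not-deep, off-window, surface, stress gain).  THE SEAM
`balancedDeepScaleGapW_of_fine_mid : BDSG_W a s ρ₁ ε₁ g σ₁ σ₂ → BalancedMidGapW ρ ρ₁ ε₁ ε g σ₁ σ₂ → BDSG_W a s ρ ε g σ₁ σ₂`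
is a CONVEX COMBINATION of the two energy inequalities (weights `t = c₂/(4(C₁⁺+c₂+1))`, `1-t`; priced constant
`min (t c₁) (c₂/4)`; the unit direction is the one of the two with the larger shear gain) and two counting inclusions
(`{scale-bad ∧ deep} ⊆ {scale-bad ∧ fine-deep} ∪ MID`, `{¬fine-deep} ⊆ {¬deep} ∪ MID`); it needs NO relation between
`(ρ, ε)` and `(ρ₁, ε₁)` and therefore ITERATES (tolerance ladder `ε₁ < ε₂ < ε`).

## §4  LAYER 2 — the typed HARMONIC ATTACK on the fine leaf (critic row 593 (3): S1 / S2 / S3), statements only.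
* S1 `HarmonicPolytypeStability` («K») — instance-free, `tsum`-free harmonic Gårding inequality for the tree's `lennardJones` on every
  ideal Barlow stacking `barlowStacking a (a√(2/3)) s` (`IsHaggSeq s`; fcc = `constHagg`, hcp = `alternatingHagg`) at every
  nearest-neighbour scale `a ∈ [19/20, 1]` (⊋ the scale-good window `[0.9565, 0.9955]`): the radius-3 truncated second variation
  dominates `λ ×` the linearised nearest-neighbour bond-stretch form, for finitely supported displacement fields.  Carries `∃ λ`
  (a certifiable NUMBER: Bloch–Floquet + interval arithmetic; census I-PHONON), NOT the census constant.
* S2 `FineChartStraightening` («R») — potential-free discrete rigidity: a `(ρ, ε₁)`-finely-deep site admits, after moving every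
  site by `≤ C ρ² ε₁ · nn`, an EXACTLY locally close-packed configuration (every site of the `(ρ-3)·nn`-ball has an exact fcc- or
  hcp-two-shell environment at ONE common scale).  «Registration supplies the reference lattice», correctly generalised: the
  reference is LOCALLY Barlow, not a Barlow stacking (two non-parallel fault planes fit in one deep ball).  Carries `∃ C` (geometry).
* S3 `HarmonicReduction ρ₁` («B») — the bridge `K → R → ∃ ε₁ > 0, TameBalancedDeepScaleGap (122/125) 0 ρ₁ ε₁ (1/450)` (the fine
  tolerance `ε₁` — the harmonic radius, `≈ 10⁻³/C` — is B's OUTPUT, because R's constant `C` is existential): Taylor expansion about the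
  straightened chart at dead-zone chart scales, first variation: forces vanish EXACTLY in homothetic fcc and hcp (site symmetry `O_h` / `D_3h`); in a general polytype only the
  in-plane components vanish (`C_3v`) and mixed layers carry an axial force `|F_z| ≲ 0.05–0.1` from the shells at `√(8/3)a₀, √3a₀`; it is NOT
  paid linearly but by COMPLETING THE SQUARE on the layer modes, `−F·v + ½⟨v,Hv⟩ ≥ −½⟨F,H⁻¹F⟩`, and `E(z) − ½⟨F,H⁻¹F⟩` is (up to cubic terms)
  the energy of the AXIALLY RELAXED stacking at lateral scale `a₀`, itself a periodic configuration, hence `≥ e⋆` per site (relaxation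
  energy `≈ F_z²/(2k_L) ≈ 6·10⁻⁵` per mixed-layer site; critic row 616 R2);
  second variation `≥ λ·stretch²` by K, cubic remainder absorbed for `ε₁ ≤ ε₀(λ, C)`, tails by `r⁻⁶` summability, boundary flux rebated by
  `#¬fine-deep`; the census constant `c₁` of the fine leaf is manufactured HERE, in the zeroth-order (equation-of-state) step
  (`c₁ ≈ e_P(a₀) − e⋆` at the window edge, capped by the compensated ISOTROPIC inclusion).  Given K and R it is IMPLIED by the target
  (`harmonicReduction_of_target`, PROVED) — strictly on the weaker side.
* `MidAll ρ₁` — `TameBalancedMidGap 4 ρ₁ ε₁ (3/50) (1/450)` for every `0 < ε₁ ≤ 3/50` (the cone consumes it at B's `ε₁`; once a prover of B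
  names `ε₁`, only that instance is owed: `rdef_of_ceg_shape_fine_mid`).

## §5  CONES (PROVED compositions).
`tbdsg_of_fine_mid_record (ε₁ ρ₁) : F → MID → TBDSG`; its three-tolerance form `tbdsg_of_fine_mid_mid_record` through `ε₂ = 3/100` (the certified
convex core of the affine energy, census TAG 192); `tbdsg_of_harmonic_midAll (ρ₁) : K → R → B ρ₁ → MidAll ρ₁ → TBDSG`; and the RDEF cones XLVII
(`rdef_of_ceg_shape_harmonic_midAll`, eight slots) / XLVII′ (`rdef_of_ceg_shape_fine_mid`, six slots) obtained by substituting into cone XLVI.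
-/

namespace Summit.AtomisticToContinuum.Crystallization.Theorems.OverbindingBudgetHarmonicNormalForm

open Filter Metric Set Topology
open scoped BigOperators Classical
open Literature.MathematicalPhysics.StatisticalMechanics
open Literature.Geometry.DiscreteGeometry (IsChargeFree bondGraph nearestDist nearestDist_le_dist nearestDist_nonneg le_nearestDist bondGraph_adj
  fccTwoShellPattern hcpTwoShellPattern)
open Summit.AtomisticToContinuum.Crystallization.Theses.OverbindingBudget (RobustDefectLimitWindows)
open Summit.AtomisticToContinuum.Crystallization.Theses.PricedLinkCensus (ChargedEnergyGap)
open Summit.AtomisticToContinuum.Crystallization.Theorems.OverbindingBudgetGradedBareness (CleanlessExcessT)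
open Summit.AtomisticToContinuum.Crystallization.Theorems.OverbindingBudgetCoherentCut (CoherentResidual)
open Summit.AtomisticToContinuum.Crystallization.Theorems.OverbindingBudgetMisfitCensusStatements (Bad Short Long)
open Summit.AtomisticToContinuum.Crystallization.Theorems.OverbindingBudgetMisfitRegistration (Framed Reg DeepReg regScaleCount)
open Summit.AtomisticToContinuum.Crystallization.Theorems.OverbindingBudgetTwoShellShape (TwoShellShape)
open Summit.AtomisticToContinuum.Crystallization.Theorems.OverbindingBudgetMisfitWindowStatements (InWindow offCount)
open Summit.AtomisticToContinuum.Crystallization.Theorems.OverbindingBudgetBalancedCensusStatements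
open Summit.AtomisticToContinuum.Crystallization.Theorems.OverbindingBudgetBalancedCensusRecord

variable {N : ℕ}

/-! ## §4  LAYER 2 — the typed HARMONIC ATTACK on the fine leaf (critic row 593 (3): S1 = K, S2 = R, S3 = B).  Statements only. -/

/-- First radial derivative `V′(r) = −r⁻¹³ + r⁻⁷` of the tree's `lennardJones r = (1/12)·(r⁻¹)¹² − (1/6)·(r⁻¹)⁶`
(`V′(1) = 0`; `V′ < 0` for `r < 1`: first-shell bonds at `d⋆ ≈ 0.9713` are COMPRESSED, `V′(d⋆) ≈ −0.233`). -/
noncomputable def ljD1 (r : ℝ) : ℝ := -(r⁻¹) ^ 13 + (r⁻¹) ^ 7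

/-- Second radial derivative `V″(r) = 13 r⁻¹⁴ − 7 r⁻⁸` (`V″(1) = 6`, `V″(d⋆) ≈ 10.7`, `V″(√2 d⋆) ≈ −0.40`; `V″ > 0` iff `r⁶ < 13/7`). -/
noncomputable def ljD2 (r : ℝ) : ℝ := 13 * (r⁻¹) ^ 14 - 7 * (r⁻¹) ^ 8

/-- Squared linearised stretch `⟪d/|d|, v⟫²` of the bond vector `d` under the relative displacement `v` (`0` for `d = 0`). -/
noncomputable def bondStretchSq (d v : EuclideanSpace ℝ (Fin 3)) : ℝ := (inner ℝ d v / ‖d‖) ^ 2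

/-- Harmonic pair form of the bond `d ≠ 0` under the relative end-point displacement `v`: the second derivative at `τ = 0` of
`τ ↦ lennardJones ‖d + τ • v‖`, i.e. `V″(|d|)·⟪d̂, v⟫² + (V′(|d|)/|d|)·(‖v‖² − ⟪d̂, v⟫²)` (longitudinal + transverse stiffness;
the transverse stiffness of a compressed bond is NEGATIVE — positivity of the lattice form is a collective, Korn-type fact). -/
noncomputable def ljBondHess (d v : EuclideanSpace ℝ (Fin 3)) : ℝ :=
  ljD2 ‖d‖ * bondStretchSq d v + ljD1 ‖d‖ / ‖d‖ * (‖v‖ ^ 2 - bondStretchSq d v)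

/-- **S1 · `HarmonicPolytypeStability` («K», CERT-type, instance-free, `tsum`-free).**  There is ONE `λ > 0` such that for every
nearest-neighbour scale `a ∈ [19/20, 1]` (⊋ the scale-good window `[122/125·49/50, 122/125·51/50] = [0.95648, 0.99552]` and `d⋆`),
every Hägg sequence `s` (every ideal Barlow stacking `barlowStacking a (a·√(2/3)) s`: in-plane spacing `a`, ideal layer spacing, all
twelve first-shell distances `= a`; fcc = `constHagg`, hcp = `alternatingHagg`, and every polytype — needed because `Framed` admits every
stacking locally, e.g. uniformly compressed dhcp is priced by the fine leaf), and every FINITELY SUPPORTED displacement field `w` of the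
stacking (support and its radius-`3` neighbourhood inside the finite window `T`), the radius-`3` truncated harmonic energy dominates
`λ ×` the first-shell bond-stretch energy:
`λ · Σ_{x ≠ z ∈ T, |x−z| ≤ 1.01 a} ⟪(z−x)^, w z − w x⟫² ≤ Σ_{x ≠ z ∈ T, |x−z| ≤ 3} ljBondHess (z − x) (w z − w x)`.
(Both sides count ordered pairs; pairs outside the support vanish on both sides, so the `T`-sums ARE the lattice sums.)  Rigid motions are
invisible to the left side and are not finitely supported; the statement is phonon (Bloch–Floquet) stability of the LJ polytypes at the
scales of the window, uniformly in the stacking — certifiable by interval arithmetic on the `3p × 3p` Bloch matrices for periods `p ≤ P₀` plus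
a layer-locality (IMS) lemma; census I-PHONON is its fcc/hcp instance at `d⋆`.  K carries `∃ λ` (a NUMBER), not the census constant.
[critic row 593 (3) S1; Hudson–Ortner 2012 Thm 3.6 / Braun 2016 §3.2 shape; Wallace, Thermodynamics of Crystals §§10–11] -/
def HarmonicPolytypeStability : Prop :=
  ∃ lam : ℝ, 0 < lam ∧ ∀ (a : ℝ), 19 / 20 ≤ a → a ≤ 1 → ∀ (s : ℤ → ℤ), IsHaggSeq s →
    ∀ (T : Finset (EuclideanSpace ℝ (Fin 3))),
      (↑T : Set (EuclideanSpace ℝ (Fin 3))) ⊆ barlowStacking a (a * Real.sqrt (2 / 3)) s →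
      ∀ (w : EuclideanSpace ℝ (Fin 3) → EuclideanSpace ℝ (Fin 3)),
        (∀ x, w x ≠ 0 → x ∈ T ∧ ∀ z ∈ barlowStacking a (a * Real.sqrt (2 / 3)) s, dist x z ≤ 3 → z ∈ T) →
        lam * (∑ x ∈ T, ∑ z ∈ T, if x ≠ z ∧ dist x z ≤ 101 / 100 * a then bondStretchSq (z - x) (w z - w x) else 0)
          ≤ ∑ x ∈ T, ∑ z ∈ T, if x ≠ z ∧ dist x z ≤ 3 then ljBondHess (z - x) (w z - w x) else 0

/-- **S2 · `FineChartStraightening` («R», potential-free discrete rigidity, ATTACKABLE-M).**  There is `C ≥ 0` such that: whenever a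
site `i` is `(ρ, ε₁)`-deeply registered (`ρ ≥ 4`) with `C ρ² ε₁ ≤ 1/100`, the configuration can be STRAIGHTENED — moving every site by at
most `C ρ² ε₁ · nn_i` — to a configuration `z` that is EXACTLY locally close-packed at ONE common scale `a₀` (`|a₀ − nn_i| ≤ C ε₁ nn_i`) on the
`(ρ−3)·nn_i`-ball: every site there has an exact linear-isometric fcc- or hcp-two-shell environment of scale `a₀` in `z`, covering every
`z`-site within `29/20·a₀`.  «Registration supplies the reference lattice», generalised as it must be: the reference is LOCALLY Barlow
(each 18-environment exact), not a Barlow stacking — two stacking-fault planes on non-parallel `{111}` planes fit disjointly in one deep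
ball, every site exactly framed.  Mechanism: develop the local frames from `i` outward (adjacent framed sites share ≥ 4 non-coplanar
pattern points, so their similarity charts agree to `O(ε₁)`); a ball is simply connected and each exact environment is flat, so the
development has no holonomy; the `ρ²` is curvature-type drift (a bent crystal).  R carries `∃ C` (geometry), not the census constant.
[critic row 593 (3) S2; FJM 2002 (rigidity shape), Faraco–Zhong 2005 (conformal rigidity, n ≥ 3); discrete: Schmidt 2009, Braun–Schmidt 2013] -/
def FineChartStraightening : Prop :=
  ∃ C : ℝ, 0 ≤ C ∧ ∀ (ρ ε₁ : ℝ), 4 ≤ ρ → 0 < ε₁ → C * ρ ^ 2 * ε₁ ≤ 1 / 100 →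
    ∀ (N : ℕ) (y : Fin N → EuclideanSpace ℝ (Fin 3)) (i : Fin N), Function.Injective y → DeepReg ρ ε₁ (1 / 450) y i →
      ∃ (a₀ : ℝ) (z : Fin N → EuclideanSpace ℝ (Fin 3)),
        |a₀ - nearestDist y i| ≤ C * ε₁ * nearestDist y i ∧
        (∀ j, dist (z j) (y j) ≤ C * ρ ^ 2 * ε₁ * nearestDist y i) ∧
        ∀ j, dist (y j) (y i) ≤ (ρ - 3) * nearestDist y i →
          ∃ (A : EuclideanSpace ℝ (Fin 3) →ₗᵢ[ℝ] EuclideanSpace ℝ (Fin 3)) (P : Finset (EuclideanSpace ℝ (Fin 3))),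
            (P = fccTwoShellPattern ∨ P = hcpTwoShellPattern) ∧
            (∀ v ∈ P, ∃ k, z k = z j + a₀ • A v) ∧
            ∀ k, k ≠ j → dist (z k) (z j) ≤ 29 / 20 * a₀ → ∃ v ∈ P, z k = z j + a₀ • A v

/-- **S3 · `HarmonicReduction ρ₁` («B», the bridge; ATTACKABLE-L).**  `K → R → ∃ ε₁ > 0, TameBalancedDeepScaleGap (122/125) 0 ρ₁ ε₁ (1/450)`:
harmonic stability and fine straightening give the balanced deep census at SOME fine tolerance `ε₁` (the harmonic radius, `≈ 10⁻³/C`) and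
the depth `ρ₁`.  Route (memo §3): Taylor-expand `E` about the straightened chart `z` of R at DEAD-ZONE chart scales (`a₀ ↦ d⋆` whenever
`|a₀ − d⋆| ≤ ε₁ d⋆`, so that zero-slack regions are expanded about a STRESS-FREE reference); zeroth order `Σ_i e_loc(a₀,i) ≥ n e⋆ +
½ M (a₀ − d⋆)² n − C·#cuts` (every homothetic ideal stacking is a periodic configuration, `≥ e⋆` per particle by definition of `e⋆`; word
periodisation costs boundary); first order: the forces of the reference vanish EXACTLY for homothetic fcc and hcp (site symmetry `O_h` / `D_3h`) — there the
first variation is a pure boundary flux; in a general polytype the in-plane force components vanish (`C_3v`) but mixed layers carry an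
AXIAL force from the shells beyond the two-shell range (`√(8/3) a₀ ≈ 1.63 a₀` and `√3 a₀`, inside the radius-3 truncation; `|F_z| ≲ 0.05–0.1`);
this is NOT paid linearly: COMPLETE THE SQUARE on the layer-breathing modes, `−F·v + ½⟨v,Hv⟩ ≥ −½⟨F,H⁻¹F⟩` (K makes `H ≥ λS`, the layer
stiffness `k_L > 0`), and `E(z) − ½⟨F,H⁻¹F⟩` equals, up to the cubic remainder at `|H⁻¹F| ≈ 10⁻³a₀`, the energy of the AXIALLY RELAXED
stacking at lateral scale `a₀` — a periodic configuration (periodise the Hägg word at vanishing cost), hence `≥ e⋆` per site, and for priced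
(scale-bad, near-similarity) regions `≥ e⋆ + e_iso − F_z²/(2k_L)·[mixed fraction]` with `F_z²/(2k_L) ≈ 6·10⁻⁵ ≪ e_iso ≈ 6·10⁻³` (fcc/hcp
regions lose nothing: `F = 0`); so no polytype-excess slack and no `ε₁ ≲ 10⁻⁴/C` is needed and `ε₀` is set by the cubic step (critic row 616 R2); second order `≥ λ·stretch²` by K on
charts of radius `≍ 1/√ε₁` with IMS localisation loss `O(ε₁) ≪ λ`; cubic remainder `≤ (|V‴|/3)|v|·|v|² ≤ 70·(2Cρ₁²ε₁)·|v|²` absorbed; tails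
`r > 3` by `r⁻⁶` summability against the same budgets; boundary flux `≤ 13·#¬fine-deep` rebated.  The census constant of the fine leaf is
BORN HERE: `c₁ ≈ λ·g₀²` with `g₀ = 0.0152` the distance of the window edge from `d⋆` in units of `d⋆`.  Given K and R, B is IMPLIED by the
target (`harmonicReduction_of_target`): strictly on the weaker side. [critic row 593 (3) S3; E–Ming 2007, Ortner–Theil 2013 (shape)] -/
def HarmonicReduction (ρ₁ : ℝ) : Prop :=
  HarmonicPolytypeStability → FineChartStraightening →
    ∃ ε₁ : ℝ, 0 < ε₁ ∧ TameBalancedDeepScaleGap (122 / 125) 0 ρ₁ ε₁ (1 / 450)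

/-- **`MidAll ρ₁`** — the MID census from depth/tolerance `(ρ₁, ε₁)` up to the registration frame of record `(4, 3/50)`, at EVERY fine
tolerance `0 < ε₁ ≤ 3/50` (constants may depend on `ε₁`; expected `c(ε₁) ≍ λ ε₁² / ρ₁³`).  The cone below consumes it at the one `ε₁`
delivered by B; a prover of B names `ε₁`, after which only `TameBalancedMidGap 4 ρ₁ ε₁ (3/50) (1/450)` is owed (`tbdsg_of_fine_mid_record`). -/
def MidAll (ρ₁ : ℝ) : Prop :=
  ∀ ε₁ : ℝ, 0 < ε₁ → ε₁ ≤ 3 / 50 → TameBalancedMidGap 4 ρ₁ ε₁ (3 / 50) (1 / 450)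

/-- B is on the WEAKER side: given nothing at all, the target of record implies `HarmonicReduction ρ₁` for every `ρ₁ ≥ 4`
(witness `ε₁ = 3/50`). [this file] -/
theorem harmonicReduction_of_target {ρ₁ : ℝ} (hρ : 4 ≤ ρ₁) (h : TameBalancedDeepScaleGap (122 / 125) 0 4 (3 / 50) (1 / 450)) :
    HarmonicReduction ρ₁ :=
  fun _ _ => ⟨3 / 50, by norm_num, fine_of_target le_rfl hρ h⟩

/-! ## §5  CONES (PROVED compositions) -/

/-- **Record seam.** `TameBalancedDeepScaleGap (122/125) 0 ρ₁ ε₁ (1/450) → TameBalancedMidGap 4 ρ₁ ε₁ (3/50) (1/450) → TBDSG`. [this file] -/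
theorem tbdsg_of_fine_mid_record (ε₁ ρ₁ : ℝ) (hF : TameBalancedDeepScaleGap (122 / 125) 0 ρ₁ ε₁ (1 / 450))
    (hM : TameBalancedMidGap 4 ρ₁ ε₁ (3 / 50) (1 / 450)) : TameBalancedDeepScaleGap (122 / 125) 0 4 (3 / 50) (1 / 450) :=
  tameBalancedDeepScaleGap_of_fine_mid hF hM

/-- **Record seam, three tolerances** (`ε₁ < 3/100 < 3/50`; `3/100` = the certified convex core of the affine energy, census TAG 192):
fine leaf ∧ MID(ε₁ → 3/100) ∧ MID(3/100 → 3/50) ⇒ TBDSG. [this file] -/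
theorem tbdsg_of_fine_mid_mid_record (ε₁ ρ₁ ρ₂ : ℝ) (hF : TameBalancedDeepScaleGap (122 / 125) 0 ρ₁ ε₁ (1 / 450))
    (hM₁ : TameBalancedMidGap ρ₂ ρ₁ ε₁ (3 / 100) (1 / 450)) (hM₂ : TameBalancedMidGap 4 ρ₂ (3 / 100) (3 / 50) (1 / 450)) :
    TameBalancedDeepScaleGap (122 / 125) 0 4 (3 / 50) (1 / 450) :=
  tameBalancedDeepScaleGap_of_fine_mid_mid hF hM₁ hM₂

/-- **THE HARMONIC CONE for slot 3.** `K → R → B ρ₁ → MidAll ρ₁ → TameBalancedDeepScaleGap (122/125) 0 4 (3/50) (1/450)`. [this file] -/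
theorem tbdsg_of_harmonic_midAll (ρ₁ : ℝ) (hK : HarmonicPolytypeStability) (hR : FineChartStraightening)
    (hB : HarmonicReduction ρ₁) (hM : MidAll ρ₁) : TameBalancedDeepScaleGap (122 / 125) 0 4 (3 / 50) (1 / 450) := by
  obtain ⟨ε₁, hε₁, hF⟩ := hB hK hR
  have hF' : TameBalancedDeepScaleGap (122 / 125) 0 ρ₁ (min ε₁ (3 / 50)) (1 / 450) :=
    tameBalancedDeepScaleGap_anti_tol (min_le_left _ _) hF
  exact tameBalancedDeepScaleGap_of_fine_mid hF' (hM _ (lt_min hε₁ (by norm_num)) (min_le_right _ _))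

/-- **CONE XLVII (record, eight slots)** — cone XLVI with slot 3 in harmonic normal form:
`ChargedEnergyGap → TwoShellShape (1/100) (3/50) (1/450) → K → R → B ρ₁ → MidAll ρ₁ → CleanlessExcessT → CoherentResidual 10 →
RobustDefectLimitWindows`. [this file] -/
theorem rdef_of_ceg_shape_harmonic_midAll (ρ₁ : ℝ) (hCEG : ChargedEnergyGap) (hT : TwoShellShape (1 / 100) (3 / 50) (1 / 450))
    (hK : HarmonicPolytypeStability) (hR : FineChartStraightening) (hB : HarmonicReduction ρ₁) (hM : MidAll ρ₁)
    (hCE : CleanlessExcessT) (hRes : CoherentResidual 10) : RobustDefectLimitWindows :=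
  rdef_of_ceg_shape_balancedDeep_record hCEG hT (tbdsg_of_harmonic_midAll ρ₁ hK hR hB hM) hCE hRes

/-- **CONE XLVII′ (record, six slots, tolerance named)** — `ChargedEnergyGap → TwoShellShape (1/100) (3/50) (1/450) →
TameBalancedDeepScaleGap (122/125) 0 ρ₁ ε₁ (1/450) → TameBalancedMidGap 4 ρ₁ ε₁ (3/50) (1/450) → CleanlessExcessT → CoherentResidual 10 →
RobustDefectLimitWindows`. [this file] -/
theorem rdef_of_ceg_shape_fine_mid (ε₁ ρ₁ : ℝ) (hCEG : ChargedEnergyGap) (hT : TwoShellShape (1 / 100) (3 / 50) (1 / 450))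
    (hF : TameBalancedDeepScaleGap (122 / 125) 0 ρ₁ ε₁ (1 / 450)) (hM : TameBalancedMidGap 4 ρ₁ ε₁ (3 / 50) (1 / 450))
    (hCE : CleanlessExcessT) (hRes : CoherentResidual 10) : RobustDefectLimitWindows :=
  rdef_of_ceg_shape_balancedDeep_record hCEG hT (tbdsg_of_fine_mid_record ε₁ ρ₁ hF hM) hCE hRes

end Summit.AtomisticToContinuum.Crystallization.Theorems.OverbindingBudgetHarmonicNormalForm
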